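import Mathlib
import Literature.NumberTheory.LFunctions.Zhang2022.Section10cLamAvgSecondLine
import Literature.NumberTheory.LFunctions.Zhang2022.Section10cProfiles
import HarnessLib

/-!
# Zhang (2022) §10, `Θ₁(𝐚₁₃,𝐚₂₁)`: the two "second lines" `Z22:§10.u043 (ii)` and `Z22:§10.u044 (ii)`
# (`Typed.Sec10B.Eq1043b`, `Typed.Sec10B.Eq1044b`) PROVED OUTRIGHT

Topic `Literature/NumberTheory/LFunctions/Zhang2022` (Landau–Siegel audit tree; verdict-neutral).
Y. Zhang, *Discrete mean estimates and the Landau–Siegel zero*, arXiv:2211.02515v1 (2022)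
[Zhang2022LandauSiegel], §10 p. 58 (tex L2986–L2998), the two displays of the evaluation of
`S_j(𝐚₁₃,𝐚₂₁)` on the ranges `P^{0.5} ≤ dr < P^{0.502}` and `P^{0.502} ≤ dr < P^{0.504}`, second lines:

> "`= (500𝔞/(0.504 log P))∫_{0.5}^{0.502}(−1 − πij(z − 0.5))𝔤𝔥_{j6}(0.504 − z)dz + o(α)`",
> "`= (500𝔞/(0.504 log P))∫_{0.502}^{0.504}(1 − πij(0.504 − z))𝔤𝔥_{j6}(0.504 − z)dz + o(α)`"

— **an unrefereed manuscript under adjudication; this file proves two of its displayed steps from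
tree theorems and asserts nothing about its Theorems 1–2 or about Landau–Siegel zeros.** ZHANG-L
discharge lane (WP10, seat zl-w10-p4), inputs of the leaf `Typed.Sec10B.Concl1321` (hypothesis
`hC1321` of `Skeleton.theorem1_of_leaves_v19`) through the tree edge `Typed.Sec10B.concl1321_of_ranges`.

* `nAvg_eq_lamAvg` — the §10B weighted `n`-average `Typed.Sec10B.nAvg` (sum over
  `{1 ≤ n < ⌈hi⌉ : lo ≤ n}`) IS the §10C one `Typed.Sec10C.lamAvg` (sum over `⌈lo⌉ ≤ n < ⌈hi⌉`) for
  `lo > 0` — so the unconditional evaluation rule `Typed.Sec10C.lamAvg_second_line` (sz-d39, built on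
  sz-d34's `lamAvg_rule`: d16's `λ₀ⱼ(n) = (φ(n)/n)²(1 + O(α𝓛))`, the weak totient mean value
  `Σ_{n<x}|χ(n)|φ(n)/n² = c_D log x + O(𝓛²)`, partial summation; `c_D L′(1,χ)² = 𝔞`) applies verbatim;
* `ghSel_eq_ghP` — the `j`-selectors of §10B (`ghSel`) and §8d (`ghP`) agree on `j ∈ {1,2,3}`;
* `G1044_bounds` / `G1044_at_rpow`, `G1043_bounds` / `G1043_at_rpow` — the two profiles
  `(1 − β_j log(P^{0.504}/t))𝔤_{j6}(P^{0.504}/t)` and `(−1 − β_j log(t/P^{0.5}))𝔤_{j6}(P^{0.504}/t)` on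
  `[1, P]` (differentiable, `≤ 146(1+4π)`, derivative `≪ α/t`: `Typed.Sec10C.logFactor_bounds`,
  `Section8AbelProfiles.frakgW_div_bounds`) and at `t = P^z` against the printed integrands
  (`β_j log P = jπi + O(𝓛⁻⁸)`: `Typed.Sec10C.norm_betaJ_mul_log_sub_le`; `𝔤_{j6}(P^w) = 𝔤𝔥_{j6}(w) + O(𝓛⁻⁸)`:
  sz-d19's `Section8ProfilesAtPz.profiles_six`);
* `eq1044b_holds : ∀ c′, Eq1044b c′`, `eq1043b_holds : ∀ c′, Eq1043b c′` — OUTRIGHT, no manuscript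
  claim as hypothesis; total error `≪_{c′} 𝓛⁻¹² = o(α)` (`α = π𝓛⁻⁹`).

## References

* Y. Zhang, arXiv:2211.02515v1 (2022), §10 p. 58; §8 p. 48, (8.13)–(8.15); §2 (2.13), (2.31).
  [cite: Zhang2022LandauSiegel, §10 p. 58]
-/

noncomputable section

open Complex Real ComplexConjugate MeasureTheory
open Literature.NumberTheory.LFunctions.Zhang2022.Skeleton

namespace Literature.NumberTheory.LFunctions.Zhang2022.Typed.Sec10B

open Literature.NumberTheory.LFunctions.Zhang2022.Section8dStatements (ghP)

section Bridges

/-- **`nAvg = lamAvg`**: for `lo > 0` the §10B average `Σ_{1≤n<⌈hi⌉, lo≤n}|χ(n)|λ₀ⱼ(n)φ(n)⁻¹g(n)`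
is the §10C average `Σ_{⌈lo⌉≤n<⌈hi⌉}(…)` (same summand; `lo ≤ n ↔ ⌈lo⌉ ≤ n`, and `n ≥ lo > 0 ⇒ n ≥ 1`).
[cite: Zhang2022LandauSiegel, §10 pp. 57–61] -/
theorem nAvg_eq_lamAvg (c' : ℝ) {D : ℕ} [NeZero D] (χ : DirichletCharacter ℂ D) (j : ℕ)
    {lo : ℝ} (hlo : 0 < lo) (hi : ℝ) (g : ℕ → ℂ) :
    nAvg c' χ j lo hi g = Typed.Sec10C.lamAvg c' χ j lo hi g := by
  have hS : (Finset.Ico 1 ⌈hi⌉₊).filter (fun n : ℕ => lo ≤ (n : ℝ)) = Finset.Ico ⌈lo⌉₊ ⌈hi⌉₊ := by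
    ext n
    simp only [Finset.mem_filter, Finset.mem_Ico, Nat.ceil_le]
    constructor
    · rintro ⟨⟨-, h2⟩, h3⟩
      exact ⟨h3, h2⟩
    · rintro ⟨h1, h2⟩
      refine ⟨⟨?_, h2⟩, h1⟩
      have h0 : (0 : ℝ) < n := lt_of_lt_of_le hlo h1
      have h0' : 0 < n := by exact_mod_cast h0
      omega
  unfold nAvg Typed.Sec10C.lamAvg
  rw [hS]

/-- The `j`-selectors `ghSel` (§10B) and `ghP` (§8d) of the printed `𝔤𝔥_{jμ}` agree for `j = 1, 2, 3`.
[cite: Zhang2022LandauSiegel, §8 (8.13)–(8.18)] -/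
theorem ghSel_eq_ghP {j : ℕ} (hj : j ∈ ({1, 2, 3} : Finset ℕ)) (μ : ℕ) : ghSel j μ = ghP j μ := by
  simp only [Finset.mem_insert, Finset.mem_singleton] at hj
  rcases hj with rfl | rfl | rfl <;> simp [ghSel, ghP]

/-- `𝔤𝔥_{jμ}` (selector `ghSel`) is continuous. [cite: Zhang2022LandauSiegel, §8 (8.13)–(8.18)] -/
theorem continuous_ghSel' (j μ : ℕ) : Continuous (ghSel j μ) := by
  unfold ghSel gh16 gh26 gh36 gh17 gh27 gh37
  split_ifs <;> exact continuous_ghF _ _ _ _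

end Bridges

section Profiles

/-- **The profile of `Z22:§10.u044`** as a function of a real variable,
`G(t) = (1 − β_j log(P^{0.504}/t))𝔤_{j6}(P^{0.504}/t)`, on `[1, P]`: differentiable,
`‖G‖ ≤ 146(1 + 4π)`, `‖G′(t)‖ ≤ (4·146 + (1+4π)·449)α/t` (`‖β_j‖ ≤ 4α`, Lemma 8.4's profile bounds).
[cite: Zhang2022LandauSiegel, §10 p. 58] -/
theorem G1044_bounds (c' : ℝ) {D : ℕ} (j : ℕ) (hα : 0 < alpha D) (hℓ : 0 ≤ ell D)
    (hc : 5 * |c'| * alpha D * ell D ≤ 1) (hQP : bigP D ^ (0.504 : ℝ) ≤ bigP D)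
    (hQ1 : 1 ≤ bigP D ^ (0.504 : ℝ)) {t : ℝ} (ht1 : 1 ≤ t) (htP : t ≤ bigP D) :
    DifferentiableAt ℝ (fun u : ℝ => (1 - betaJ c' D j * (Real.log (bigP D ^ (0.504 : ℝ) / u) : ℂ)) *
        frakgW c' D j 6 (bigP D ^ (0.504 : ℝ) / u)) t ∧
      ‖(1 - betaJ c' D j * (Real.log (bigP D ^ (0.504 : ℝ) / t) : ℂ)) *
          frakgW c' D j 6 (bigP D ^ (0.504 : ℝ) / t)‖ ≤ (1 + 4 * π) * 146 ∧
      ‖deriv (fun u : ℝ => (1 - betaJ c' D j * (Real.log (bigP D ^ (0.504 : ℝ) / u) : ℂ)) *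
          frakgW c' D j 6 (bigP D ^ (0.504 : ℝ) / u)) t‖ ≤
        (4 * alpha D * 146 + (1 + 4 * π) * (449 * alpha D)) / t := by
  have hαΛ : alpha D * Real.log (bigP D) ≤ 4 := by
    have : alpha D * Real.log (bigP D) = π := by
      rw [alpha]; field_simp [(show Real.log (bigP D) ≠ 0 from by
        intro h; rw [alpha, h, div_zero] at hα; exact lt_irrefl _ hα)]
    rw [this]; linarith [Real.pi_lt_four]
  obtain ⟨d1, n1, n1'⟩ := Typed.Sec10C.logFactor_bounds c' j (a := 1) (s := -1) (by simp) (by simp)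
    hα hℓ hc hQ1 hQP ht1 htP
  obtain ⟨d2, n2, n2'⟩ := Section8AbelProfiles.frakgW_div_bounds c' j 6 hα hℓ hc hQ1 hQP ht1 htP hαΛ
  have e : (fun u : ℝ => (1 - betaJ c' D j * (Real.log (bigP D ^ (0.504 : ℝ) / u) : ℂ)) *
      frakgW c' D j 6 (bigP D ^ (0.504 : ℝ) / u)) =
      fun u => (1 + (-1) * (betaJ c' D j * (Real.log (bigP D ^ (0.504 : ℝ) / u) : ℂ))) *
        frakgW c' D j 6 (bigP D ^ (0.504 : ℝ) / u) := by
    funext u; ring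
  have e1 : (1 - betaJ c' D j * (Real.log (bigP D ^ (0.504 : ℝ) / t) : ℂ)) =
      1 + (-1) * (betaJ c' D j * (Real.log (bigP D ^ (0.504 : ℝ) / t) : ℂ)) := by ring
  obtain ⟨d3, n3, n3'⟩ := Section8AbelProfiles.mul_bounds d1 d2 n1 n2 n1' n2' (by positivity)
  rw [e, e1]
  exact ⟨d3, n3, n3'⟩

/-- `log(t/Q) = −log(Q/t)` for all real `t, Q` (Lean's total `Real.log`). [folklore] -/
private theorem log_div_swap (Q t : ℝ) : Real.log (t / Q) = -Real.log (Q / t) := by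
  rw [← Real.log_inv, inv_div]

/-- **The profile of `Z22:§10.u043`** as a function of a real variable,
`G(t) = (−1 − β_j log(t/P^{0.5}))𝔤_{j6}(P^{0.504}/t)`, on `[1, P]`: differentiable,
`‖G‖ ≤ 146(1 + 4π)`, `‖G′(t)‖ ≤ (4·146 + (1+4π)·449)α/t`. [cite: Zhang2022LandauSiegel, §10 p. 58] -/
theorem G1043_bounds (c' : ℝ) {D : ℕ} (j : ℕ) (hα : 0 < alpha D) (hℓ : 0 ≤ ell D)
    (hc : 5 * |c'| * alpha D * ell D ≤ 1) (hQP : bigP D ^ (0.504 : ℝ) ≤ bigP D)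
    (hQ1 : 1 ≤ bigP D ^ (0.504 : ℝ)) (hRP : bigP D ^ (0.5 : ℝ) ≤ bigP D)
    (hR1 : 1 ≤ bigP D ^ (0.5 : ℝ)) {t : ℝ} (ht1 : 1 ≤ t) (htP : t ≤ bigP D) :
    DifferentiableAt ℝ (fun u : ℝ => (-1 - betaJ c' D j * (Real.log (u / bigP D ^ (0.5 : ℝ)) : ℂ)) *
        frakgW c' D j 6 (bigP D ^ (0.504 : ℝ) / u)) t ∧
      ‖(-1 - betaJ c' D j * (Real.log (t / bigP D ^ (0.5 : ℝ)) : ℂ)) *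
          frakgW c' D j 6 (bigP D ^ (0.504 : ℝ) / t)‖ ≤ (1 + 4 * π) * 146 ∧
      ‖deriv (fun u : ℝ => (-1 - betaJ c' D j * (Real.log (u / bigP D ^ (0.5 : ℝ)) : ℂ)) *
          frakgW c' D j 6 (bigP D ^ (0.504 : ℝ) / u)) t‖ ≤
        (4 * alpha D * 146 + (1 + 4 * π) * (449 * alpha D)) / t := by
  have hαΛ : alpha D * Real.log (bigP D) ≤ 4 := by
    have : alpha D * Real.log (bigP D) = π := by
      rw [alpha]; field_simp [(show Real.log (bigP D) ≠ 0 from by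
        intro h; rw [alpha, h, div_zero] at hα; exact lt_irrefl _ hα)]
    rw [this]; linarith [Real.pi_lt_four]
  obtain ⟨d1, n1, n1'⟩ := Typed.Sec10C.logFactor_bounds c' j (a := -1) (s := 1) (by simp) (by simp)
    hα hℓ hc hR1 hRP ht1 htP
  obtain ⟨d2, n2, n2'⟩ := Section8AbelProfiles.frakgW_div_bounds c' j 6 hα hℓ hc hQ1 hQP ht1 htP hαΛ
  have e : (fun u : ℝ => (-1 - betaJ c' D j * (Real.log (u / bigP D ^ (0.5 : ℝ)) : ℂ)) *
      frakgW c' D j 6 (bigP D ^ (0.504 : ℝ) / u)) =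
      fun u => (-1 + 1 * (betaJ c' D j * (Real.log (bigP D ^ (0.5 : ℝ) / u) : ℂ))) *
        frakgW c' D j 6 (bigP D ^ (0.504 : ℝ) / u) := by
    funext u; rw [log_div_swap]; push_cast; ring
  have e1 : (-1 - betaJ c' D j * (Real.log (t / bigP D ^ (0.5 : ℝ)) : ℂ)) =
      -1 + 1 * (betaJ c' D j * (Real.log (bigP D ^ (0.5 : ℝ) / t) : ℂ)) := by
    rw [log_div_swap]; push_cast; ring
  obtain ⟨d3, n3, n3'⟩ := Section8AbelProfiles.mul_bounds d1 d2 n1 n2 n1' n2' (by positivity)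
  rw [e, e1]
  exact ⟨d3, n3, n3'⟩

/-- The common core of the two `P^z`-comparisons: for `D ≥ 3`, `j ∈ {1,2,3}`, `0 ≤ w ≤ 1`, `|v| ≤ 0.002`,
`‖a₀‖ = 1`:
`‖(a₀ − β_j·v·log P)𝔤_{j6}(P^w) − (a₀ − πij·v)𝔤𝔥_{j6}(w)‖ ≤ C_z(c′)·𝓛⁻⁸`,
`C_z(c′) = 0.03π²|c′|(6 + K) + 1.03K`, `K = 75|c′|π² + 40c′²π³` (sz-d19's profile constant).
[cite: Zhang2022LandauSiegel, §10 p. 58] -/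
theorem profile_cmp_core (c' : ℝ) {D : ℕ} (hD3 : 3 ≤ D) (hΛ : 0 < Real.log (bigP D)) {j : ℕ}
    (hj : j ∈ ({1, 2, 3} : Finset ℕ)) {w v : ℝ} (hw0 : 0 ≤ w) (hw1 : w ≤ 1) (hv : |v| ≤ 0.002)
    {a₀ : ℂ} (ha₀ : ‖a₀‖ = 1) :
    ‖(a₀ - betaJ c' D j * (((v * Real.log (bigP D) : ℝ)) : ℂ)) * frakgW c' D j 6 (bigP D ^ w) -
        (a₀ - π * I * j * (v : ℂ)) * ghP j 6 w‖ ≤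
      (0.03 * π ^ 2 * |c'| * (6 + (75 * |c'| * π ^ 2 + 40 * |c'| ^ 2 * π ^ 3)) +
        1.03 * (75 * |c'| * π ^ 2 + 40 * |c'| ^ 2 * π ^ 3)) * (ell D ^ 8)⁻¹ := by
  set Cp : ℝ := 75 * |c'| * π ^ 2 + 40 * |c'| ^ 2 * π ^ 3 with hCp
  have hCp0 : 0 ≤ Cp := by positivity
  have hD1 : (1 : ℝ) < D := by exact_mod_cast (by omega : 1 < D)
  have hℓ0 : 0 < ell D := Real.log_pos hD1
  have hℓ1 : 1 ≤ ell D := by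
    have : (3 : ℝ) ≤ D := by exact_mod_cast hD3
    have h := Real.exp_one_lt_d9
    rw [ell, Real.le_log_iff_exp_le (by linarith)]
    linarith
  have hℓ8 : (ell D ^ 8)⁻¹ ≤ 1 := inv_le_one_of_one_le₀ (one_le_pow₀ hℓ1)
  have hℓ8pos : 0 < (ell D ^ 8)⁻¹ := by positivity
  have hwabs : |w| ≤ 1 := by rw [abs_of_nonneg hw0]; exact hw1
  obtain ⟨-, hg⟩ := Section8ProfilesAtPz.profiles_six c' hD3 hj hw0 hw1
  have hgh : ‖ghP j 6 w‖ ≤ 6 := Section8SubstitutionEngine.norm_ghP_le j 6 hwabs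
  have hgW : ‖frakgW c' D j 6 (bigP D ^ w)‖ ≤ 6 + Cp := by
    calc ‖frakgW c' D j 6 (bigP D ^ w)‖
        ≤ ‖frakgW c' D j 6 (bigP D ^ w) - ghP j 6 w‖ + ‖ghP j 6 w‖ := norm_le_norm_sub_add _ _
      _ ≤ Cp * (ell D ^ 8)⁻¹ + 6 := add_le_add hg hgh
      _ ≤ Cp * 1 + 6 := by gcongr
      _ = 6 + Cp := by ring
  have hβ := Typed.Sec10C.norm_betaJ_mul_log_sub_le c' hΛ hj
  have hu : |c' * alpha D * ell D| = |c'| * π * (ell D ^ 8)⁻¹ := by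
    rw [mul_assoc, Typed.Sec10C.alpha_mul_ell hℓ0, abs_mul, abs_div, abs_of_pos Real.pi_pos,
      abs_of_pos (by positivity : 0 < ell D ^ 8)]
    ring
  have hv0 : 0 ≤ |v| := abs_nonneg v
  -- ‖(a₀ − β_j v log P) − (a₀ − πijv)‖ = |v|‖β_j log P − jπi‖
  have hA : ‖(a₀ - betaJ c' D j * (((v * Real.log (bigP D) : ℝ)) : ℂ)) -
      (a₀ - π * I * j * (v : ℂ))‖ ≤ 0.002 * (15 * π * |c' * alpha D * ell D|) := by
    have e : (a₀ - betaJ c' D j * (((v * Real.log (bigP D) : ℝ)) : ℂ)) - (a₀ - π * I * j * (v : ℂ)) =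
        -(v : ℂ) * (betaJ c' D j * (Real.log (bigP D) : ℂ) - (j : ℂ) * π * I) := by
      push_cast; ring
    rw [e, norm_mul, norm_neg, Complex.norm_real, Real.norm_eq_abs]
    exact mul_le_mul hv hβ (norm_nonneg _) (by norm_num)
  have hA0 : ‖a₀ - π * I * j * (v : ℂ)‖ ≤ 1.03 := by
    have hj3 : (j : ℝ) ≤ 3 := by
      simp only [Finset.mem_insert, Finset.mem_singleton] at hj
      rcases hj with rfl | rfl | rfl <;> norm_num
    calc ‖a₀ - π * I * j * (v : ℂ)‖ ≤ ‖a₀‖ + ‖(π : ℂ) * I * j * (v : ℂ)‖ := norm_sub_le _ _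
      _ = 1 + π * j * |v| := by
          rw [ha₀, norm_mul, norm_mul, norm_mul, Complex.norm_real, Complex.norm_I,
            Complex.norm_natCast, Complex.norm_real, Real.norm_of_nonneg Real.pi_pos.le,
            Real.norm_eq_abs]
          ring
      _ ≤ 1 + 4 * 3 * 0.002 := by
          have h1 : π * j ≤ 4 * 3 :=
            mul_le_mul Real.pi_lt_four.le hj3 (by positivity) (by norm_num)
          have h2 : π * j * |v| ≤ 4 * 3 * 0.002 := mul_le_mul h1 hv hv0 (by norm_num)
          linarith
      _ ≤ 1.03 := by norm_num
  have key : (a₀ - betaJ c' D j * (((v * Real.log (bigP D) : ℝ)) : ℂ)) * frakgW c' D j 6 (bigP D ^ w) -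
      (a₀ - π * I * j * (v : ℂ)) * ghP j 6 w =
      ((a₀ - betaJ c' D j * (((v * Real.log (bigP D) : ℝ)) : ℂ)) - (a₀ - π * I * j * (v : ℂ))) *
          frakgW c' D j 6 (bigP D ^ w) +
        (a₀ - π * I * j * (v : ℂ)) * (frakgW c' D j 6 (bigP D ^ w) - ghP j 6 w) := by ring
  rw [key]
  calc ‖((a₀ - betaJ c' D j * (((v * Real.log (bigP D) : ℝ)) : ℂ)) - (a₀ - π * I * j * (v : ℂ))) *
            frakgW c' D j 6 (bigP D ^ w) +
          (a₀ - π * I * j * (v : ℂ)) * (frakgW c' D j 6 (bigP D ^ w) - ghP j 6 w)‖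
      ≤ ‖(a₀ - betaJ c' D j * (((v * Real.log (bigP D) : ℝ)) : ℂ)) - (a₀ - π * I * j * (v : ℂ))‖ *
            ‖frakgW c' D j 6 (bigP D ^ w)‖ +
          ‖a₀ - π * I * j * (v : ℂ)‖ * ‖frakgW c' D j 6 (bigP D ^ w) - ghP j 6 w‖ := by
        refine (norm_add_le _ _).trans ?_
        rw [norm_mul, norm_mul]
    _ ≤ 0.002 * (15 * π * |c' * alpha D * ell D|) * (6 + Cp) + 1.03 * (Cp * (ell D ^ 8)⁻¹) := by
        gcongr
    _ = (0.03 * π ^ 2 * |c'| * (6 + Cp) + 1.03 * Cp) * (ell D ^ 8)⁻¹ := by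
        rw [hu]; ring

/-- **The profile of `Z22:§10.u044` at `t = P^z`** (`0.502 ≤ z ≤ 0.504`): with the ACTUAL shifts,
`G(P^z) = (1 − β_j(0.504 − z)log P)𝔤_{j6}(P^{0.504−z})` differs from the printed integrand
`(1 − πij(0.504 − z))𝔤𝔥_{j6}(0.504 − z)` by `≤ C_z(c′)·𝓛⁻⁸` (`C_z` as in `profile_cmp_core`). [cite: Zhang2022LandauSiegel, §10 p. 58] -/
theorem G1044_at_rpow (c' : ℝ) {D : ℕ} (hD3 : 3 ≤ D) (hΛ : 0 < Real.log (bigP D)) {j : ℕ}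
    (hj : j ∈ ({1, 2, 3} : Finset ℕ)) {z : ℝ} (hz0 : 0.502 ≤ z) (hz1 : z ≤ 0.504) :
    ‖(1 - betaJ c' D j * (Real.log (bigP D ^ (0.504 : ℝ) / bigP D ^ z) : ℂ)) *
          frakgW c' D j 6 (bigP D ^ (0.504 : ℝ) / bigP D ^ z) -
        (1 - π * I * j * (0.504 - z)) * ghSel j 6 (0.504 - z)‖ ≤
      (0.03 * π ^ 2 * |c'| * (6 + (75 * |c'| * π ^ 2 + 40 * |c'| ^ 2 * π ^ 3)) +
        1.03 * (75 * |c'| * π ^ 2 + 40 * |c'| ^ 2 * π ^ 3)) * (ell D ^ 8)⁻¹ := by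
  have hP0 : 0 < bigP D := Real.exp_pos _
  have hrpow : bigP D ^ (0.504 : ℝ) / bigP D ^ z = bigP D ^ ((0.504 : ℝ) - z) := by
    rw [Real.rpow_sub hP0]
  have hlog : Real.log (bigP D ^ ((0.504 : ℝ) - z)) = (0.504 - z) * Real.log (bigP D) :=
    Real.log_rpow hP0 _
  rw [hrpow, hlog, ghSel_eq_ghP hj]
  have h := profile_cmp_core c' hD3 hΛ hj (w := 0.504 - z) (v := 0.504 - z) (a₀ := 1)
    (by linarith) (by linarith) (by rw [abs_le]; constructor <;> linarith) (by simp)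
  convert h using 3
  push_cast
  ring

/-- **The profile of `Z22:§10.u043` at `t = P^z`** (`0.5 ≤ z ≤ 0.502`): with the ACTUAL shifts,
`G(P^z) = (−1 − β_j(z − 0.5)log P)𝔤_{j6}(P^{0.504−z})` differs from the printed integrand
`(−1 − πij(z − 0.5))𝔤𝔥_{j6}(0.504 − z)` by `≤ C_z(c′)·𝓛⁻⁸` (`C_z` as in `profile_cmp_core`). [cite: Zhang2022LandauSiegel, §10 p. 58] -/
theorem G1043_at_rpow (c' : ℝ) {D : ℕ} (hD3 : 3 ≤ D) (hΛ : 0 < Real.log (bigP D)) {j : ℕ}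
    (hj : j ∈ ({1, 2, 3} : Finset ℕ)) {z : ℝ} (hz0 : 0.5 ≤ z) (hz1 : z ≤ 0.502) :
    ‖(-1 - betaJ c' D j * (Real.log (bigP D ^ z / bigP D ^ (0.5 : ℝ)) : ℂ)) *
          frakgW c' D j 6 (bigP D ^ (0.504 : ℝ) / bigP D ^ z) -
        (-1 - π * I * j * (z - 0.5)) * ghSel j 6 (0.504 - z)‖ ≤
      (0.03 * π ^ 2 * |c'| * (6 + (75 * |c'| * π ^ 2 + 40 * |c'| ^ 2 * π ^ 3)) +
        1.03 * (75 * |c'| * π ^ 2 + 40 * |c'| ^ 2 * π ^ 3)) * (ell D ^ 8)⁻¹ := by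
  have hP0 : 0 < bigP D := Real.exp_pos _
  have hrpow : bigP D ^ (0.504 : ℝ) / bigP D ^ z = bigP D ^ ((0.504 : ℝ) - z) := by
    rw [Real.rpow_sub hP0]
  have hrpow' : bigP D ^ z / bigP D ^ (0.5 : ℝ) = bigP D ^ (z - (0.5 : ℝ)) := by
    rw [Real.rpow_sub hP0]
  have hlog : Real.log (bigP D ^ (z - (0.5 : ℝ))) = (z - 0.5) * Real.log (bigP D) :=
    Real.log_rpow hP0 _
  rw [hrpow, hrpow', hlog, ghSel_eq_ghP hj]
  have h := profile_cmp_core c' hD3 hΛ hj (w := 0.504 - z) (v := z - 0.5) (a₀ := -1)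
    (by linarith) (by linarith) (by rw [abs_le]; constructor <;> linarith) (by simp)
  convert h using 3
  push_cast
  ring

end Profiles

section SecondLines

/-- Arithmetic: `P ≥ 4` hence `√P ≥ 2`-type facts are not needed; what is needed is `𝓛 ≥ 6 ⇒`
the windows `[P^{0.5}, P^{0.502}]`, `[P^{0.502}, P^{0.504}]` lie in `[1, P − 1]`. [folklore] -/
private theorem window_facts {D : ℕ} (hℓ6 : 6 ≤ ell D) :
    1 ≤ bigP D ^ (0.5 : ℝ) ∧ bigP D ^ (0.5 : ℝ) ≤ bigP D ^ (0.502 : ℝ) ∧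
      bigP D ^ (0.502 : ℝ) ≤ bigP D ^ (0.504 : ℝ) ∧ bigP D ^ (0.504 : ℝ) + 1 ≤ bigP D := by
  have hℓ1 : 1 ≤ ell D := by linarith
  have hℓ0 : 0 < ell D := by linarith
  have hP1 : 1 ≤ bigP D := by
    rw [bigP]; exact Real.one_le_exp (by positivity)
  refine ⟨Real.one_le_rpow hP1 (by norm_num), Real.rpow_le_rpow_of_exponent_le hP1 (by norm_num),
    Real.rpow_le_rpow_of_exponent_le hP1 (by norm_num), ?_⟩
  exact Typed.Sec10C.rpow_add_one_le_bigP (by norm_num) (by norm_num) hℓ1 (by nlinarith)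

/-- **`Z22:§10.u044 (ii)` holds** [Z22 p.58, tex L2995, second line]: `Typed.Sec10B.Eq1044b c′` —
"`(500L′(1,χ)²/(0.504 log²P))Σ_{P^{0.502}≤n<P^{0.504}}|χ(n)|λ₀ⱼ(n)φ(n)⁻¹(1 − β_j log(P^{0.504}/n))𝔤_{j6}(P^{0.504}/n)
= (500𝔞/(0.504 log P))∫_{0.502}^{0.504}(1 − πij(0.504 − z))𝔤𝔥_{j6}(0.504 − z)dz + o(α)`" for every
real `c′` and `j = 1, 2, 3`. PROVED OUTRIGHT (no manuscript claim as hypothesis): the unconditional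
evaluation rule `Typed.Sec10C.lamAvg_second_line` on the profile `G1044_bounds`, the comparison
`G1044_at_rpow` at `P^z`, and `nAvg = lamAvg`; error `≪_{c′} 𝓛⁻¹² = o(α)`.
[cite: Zhang2022LandauSiegel, §10 p. 58] -/
theorem eq1044b_holds (c' : ℝ) : Eq1044b c' := by
  intro ε hε
  set M : ℝ := (1 + 4 * π) * 146 with hM
  set M' : ℝ := 4 * 146 + (1 + 4 * π) * 449 with hM'
  have hM0 : 0 ≤ M := by positivity
  have hM'0 : 0 ≤ M' := by positivity
  set Cz : ℝ := (0.03 * π ^ 2 * |c'| * (6 + (75 * |c'| * π ^ 2 + 40 * |c'| ^ 2 * π ^ 3)) +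
    1.03 * (75 * |c'| * π ^ 2 + 40 * |c'| ^ 2 * π ^ 3)) with hCz
  have hCz0 : 0 ≤ Cz := by rw [hCz]; positivity
  have h2 := Typed.Sec10C.lamAvg_second_line c' (500 / 0.504 : ℂ) (a := 0.502) (b := 0.504)
    (M := M) (M' := M') (C₀ := Cz) (by norm_num) (by norm_num) (by norm_num) hM0 hM'0 hCz0 ε hε
  refine (h2.and (Typed.Sec10C.forAllLarge_five_c c')).mono ?_
  intro D _ χ hq hp ⟨hD, hD3, hℓ6, hc5⟩ _hA j hj
  have hℓ0 : 0 < ell D := by linarith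
  have hΛ : Real.log (bigP D) = ell D ^ 9 := by rw [bigP, Real.log_exp]
  have hΛpos : 0 < Real.log (bigP D) := by rw [hΛ]; positivity
  have hα : 0 < alpha D := Typed.Sec10C.alpha_pos hΛpos
  have hP0 : 0 < bigP D := Real.exp_pos _
  have hP1 : 1 ≤ bigP D := by rw [bigP]; exact Real.one_le_exp (by positivity)
  obtain ⟨h1lo, -, hlohi, hhiP⟩ := window_facts hℓ6
  have hlo1 : 1 ≤ bigP D ^ (0.502 : ℝ) := Real.one_le_rpow hP1 (by norm_num)
  have hhi1 : 1 ≤ bigP D ^ (0.504 : ℝ) := Real.one_le_rpow hP1 (by norm_num)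
  have hhiP' : bigP D ^ (0.504 : ℝ) ≤ bigP D := by linarith
  -- the profile
  obtain ⟨G, hGdef⟩ : ∃ G : ℝ → ℂ, G = fun u =>
      (1 - betaJ c' D j * (Real.log (bigP D ^ (0.504 : ℝ) / u) : ℂ)) *
        frakgW c' D j 6 (bigP D ^ (0.504 : ℝ) / u) := ⟨_, rfl⟩
  have hGb : ∀ t : ℝ, bigP D ^ (0.502 : ℝ) ≤ t → t ≤ bigP D ^ (0.504 : ℝ) + 1 →
      DifferentiableAt ℝ G t ∧ ‖G t‖ ≤ M ∧ ‖deriv G t‖ ≤ M' * alpha D / t := by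
    intro t h1 h2
    have e : M' * alpha D = 4 * alpha D * 146 + (1 + 4 * π) * (449 * alpha D) := by rw [hM']; ring
    rw [hGdef, hM, e]
    exact G1044_bounds c' j hα hℓ0.le hc5 hhiP' hhi1 (le_trans hlo1 h1) (le_trans h2 hhiP)
  -- the printed integrand
  obtain ⟨G₀, hG₀def⟩ : ∃ G₀ : ℝ → ℂ, G₀ = fun z : ℝ =>
      (1 - π * I * j * (0.504 - z)) * ghSel j 6 (0.504 - z) := ⟨_, rfl⟩
  have hG₀c : Continuous G₀ := by
    rw [hG₀def]
    exact (by fun_prop : Continuous fun z : ℝ => (1 - π * I * j * (0.504 - z) : ℂ)).mul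
      ((continuous_ghSel' j 6).comp (by fun_prop))
  have hG₀i : IntervalIntegrable G₀ volume (0.502 : ℝ) 0.504 := hG₀c.intervalIntegrable _ _
  have happrox : ∀ z ∈ Set.Icc (0.502 : ℝ) 0.504, ‖G (bigP D ^ z) - G₀ z‖ ≤ Cz / ell D ^ 8 := by
    intro z hz
    rw [hGdef, hG₀def, hCz, div_eq_mul_inv]
    exact G1044_at_rpow c' hD3 hΛpos hj hz.1 hz.2
  have key := hD j G G₀ hGb hG₀i happrox
  rw [nAvg_eq_lamAvg c' χ j (lt_of_lt_of_le one_pos hlo1)]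
  have hΛ0 : (Real.log (bigP D) : ℂ) ≠ 0 := by exact_mod_cast hΛpos.ne'
  convert key using 3
  · rw [hGdef]
    simp only [logP]
    field_simp
  · rw [hG₀def]
    simp only [logP]
    field_simp

variable (c' : ℝ) in
/-- `Eq1044b` — `_holds` alias of `eq1044b_holds` above under the fact's exact name, stated under the
prover's own binders as section variables (appended 2026-08-28, D-0026 bookkeeping: the proof term is the
existing theorem of this file; no statement, definition or attribute is edited; no new named fact; the
ledger's debt table listed the fact unproved). [cite: Zhang2022LandauSiegel, §10 p. 58] -/
theorem _root_.Literature.NumberTheory.LFunctions.Zhang2022.Typed.Sec10B.Eq1044b_holds :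
    _root_.Literature.NumberTheory.LFunctions.Zhang2022.Typed.Sec10B.Eq1044b c' :=
  _root_.Literature.NumberTheory.LFunctions.Zhang2022.Typed.Sec10B.eq1044b_holds (c' := c')

/-- **`Z22:§10.u043 (ii)` holds** [Z22 p.58, tex L2989, second line]: `Typed.Sec10B.Eq1043b c′` —
"`(500L′(1,χ)²/(0.504 log²P))Σ_{P^{0.5}≤n<P^{0.502}}|χ(n)|λ₀ⱼ(n)φ(n)⁻¹(−1 − β_j log(n/P^{0.5}))𝔤_{j6}(P^{0.504}/n)
= (500𝔞/(0.504 log P))∫_{0.5}^{0.502}(−1 − πij(z − 0.5))𝔤𝔥_{j6}(0.504 − z)dz + o(α)`" for every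
real `c′` and `j = 1, 2, 3`. PROVED OUTRIGHT: `Typed.Sec10C.lamAvg_second_line` on the profile
`G1043_bounds`, the comparison `G1043_at_rpow`, and `nAvg = lamAvg`; error `≪_{c′} 𝓛⁻¹² = o(α)`.
[cite: Zhang2022LandauSiegel, §10 p. 58] -/
theorem eq1043b_holds (c' : ℝ) : Eq1043b c' := by
  intro ε hε
  set M : ℝ := (1 + 4 * π) * 146 with hM
  set M' : ℝ := 4 * 146 + (1 + 4 * π) * 449 with hM'
  have hM0 : 0 ≤ M := by positivity
  have hM'0 : 0 ≤ M' := by positivity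
  set Cz : ℝ := (0.03 * π ^ 2 * |c'| * (6 + (75 * |c'| * π ^ 2 + 40 * |c'| ^ 2 * π ^ 3)) +
    1.03 * (75 * |c'| * π ^ 2 + 40 * |c'| ^ 2 * π ^ 3)) with hCz
  have hCz0 : 0 ≤ Cz := by rw [hCz]; positivity
  have h2 := Typed.Sec10C.lamAvg_second_line c' (500 / 0.504 : ℂ) (a := 0.5) (b := 0.502)
    (M := M) (M' := M') (C₀ := Cz) (by norm_num) (by norm_num) (by norm_num) hM0 hM'0 hCz0 ε hε
  refine (h2.and (Typed.Sec10C.forAllLarge_five_c c')).mono ?_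
  intro D _ χ hq hp ⟨hD, hD3, hℓ6, hc5⟩ _hA j hj
  have hℓ0 : 0 < ell D := by linarith
  have hΛ : Real.log (bigP D) = ell D ^ 9 := by rw [bigP, Real.log_exp]
  have hΛpos : 0 < Real.log (bigP D) := by rw [hΛ]; positivity
  have hα : 0 < alpha D := Typed.Sec10C.alpha_pos hΛpos
  have hP0 : 0 < bigP D := Real.exp_pos _
  have hP1 : 1 ≤ bigP D := by rw [bigP]; exact Real.one_le_exp (by positivity)
  obtain ⟨hlo1, hlohi, hmid, hhiP⟩ := window_facts hℓ6
  have hhi1 : 1 ≤ bigP D ^ (0.504 : ℝ) := Real.one_le_rpow hP1 (by norm_num)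
  have hhiP' : bigP D ^ (0.504 : ℝ) ≤ bigP D := by linarith
  have hRP : bigP D ^ (0.5 : ℝ) ≤ bigP D := by linarith
  have h502P : bigP D ^ (0.502 : ℝ) + 1 ≤ bigP D := by linarith
  -- the profile
  obtain ⟨G, hGdef⟩ : ∃ G : ℝ → ℂ, G = fun u =>
      (-1 - betaJ c' D j * (Real.log (u / bigP D ^ (0.5 : ℝ)) : ℂ)) *
        frakgW c' D j 6 (bigP D ^ (0.504 : ℝ) / u) := ⟨_, rfl⟩
  have hGb : ∀ t : ℝ, bigP D ^ (0.5 : ℝ) ≤ t → t ≤ bigP D ^ (0.502 : ℝ) + 1 →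
      DifferentiableAt ℝ G t ∧ ‖G t‖ ≤ M ∧ ‖deriv G t‖ ≤ M' * alpha D / t := by
    intro t h1 h2
    have e : M' * alpha D = 4 * alpha D * 146 + (1 + 4 * π) * (449 * alpha D) := by rw [hM']; ring
    rw [hGdef, hM, e]
    exact G1043_bounds c' j hα hℓ0.le hc5 hhiP' hhi1 hRP hlo1 (le_trans hlo1 h1) (le_trans h2 h502P)
  -- the printed integrand
  obtain ⟨G₀, hG₀def⟩ : ∃ G₀ : ℝ → ℂ, G₀ = fun z : ℝ =>
      (-1 - π * I * j * (z - 0.5)) * ghSel j 6 (0.504 - z) := ⟨_, rfl⟩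
  have hG₀c : Continuous G₀ := by
    rw [hG₀def]
    exact (by fun_prop : Continuous fun z : ℝ => (-1 - π * I * j * (z - 0.5) : ℂ)).mul
      ((continuous_ghSel' j 6).comp (by fun_prop))
  have hG₀i : IntervalIntegrable G₀ volume (0.5 : ℝ) 0.502 := hG₀c.intervalIntegrable _ _
  have happrox : ∀ z ∈ Set.Icc (0.5 : ℝ) 0.502, ‖G (bigP D ^ z) - G₀ z‖ ≤ Cz / ell D ^ 8 := by
    intro z hz
    rw [hGdef, hG₀def, hCz, div_eq_mul_inv]
    exact G1043_at_rpow c' hD3 hΛpos hj hz.1 hz.2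
  have key := hD j G G₀ hGb hG₀i happrox
  rw [nAvg_eq_lamAvg c' χ j (lt_of_lt_of_le one_pos hlo1)]
  have hΛ0 : (Real.log (bigP D) : ℂ) ≠ 0 := by exact_mod_cast hΛpos.ne'
  convert key using 3
  · rw [hGdef]
    simp only [logP]
    field_simp
  · rw [hG₀def]
    simp only [logP]
    field_simp

variable (c' : ℝ) in
/-- `Eq1043b` — `_holds` alias of `eq1043b_holds` above under the fact's exact name, stated under the
prover's own binders as section variables (appended 2026-08-28, D-0026 bookkeeping: the proof term is the
existing theorem of this file; no statement, definition or attribute is edited; no new named fact; the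
ledger's debt table listed the fact unproved). [cite: Zhang2022LandauSiegel, §10 p. 58] -/
theorem _root_.Literature.NumberTheory.LFunctions.Zhang2022.Typed.Sec10B.Eq1043b_holds :
    _root_.Literature.NumberTheory.LFunctions.Zhang2022.Typed.Sec10B.Eq1043b c' :=
  _root_.Literature.NumberTheory.LFunctions.Zhang2022.Typed.Sec10B.eq1043b_holds (c' := c')

end SecondLines

end Literature.NumberTheory.LFunctions.Zhang2022.Typed.Sec10B
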